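import Summits.QuantumFields.BalabanUV.Beta.GAN24.FibreRateTBlock
import Summits.QuantumFields.BalabanUV.Beta.GAN24.SymbolRate

/-!
# `BalabanUV.Beta.GAN24.FibreRateTBlockRate` — binder row G-an2-4 / (CONV-C), road P1-fibre, self-row **P1-Y11t\*** (sub-part of p1 row L11,
# division agreed with the L11 owner in CLAIMS l.3039/l.3094), part 2: the PER-COORDINATE ENGINE — King's scaled symbol on the EXTENDED
# zone, the reading-factor majorant, and their two-level rates

NOT IN PRINT; OUR PROOF ATTEMPT.  HONEST FRAMING (cell contract, verbatim): «discharging `BetaPertH` makes Bałaban's UV stability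
UNCONDITIONAL — a real constructive-QFT result; it is NOT the continuum limit and NOT the Clay problem.»  HONEST DEPENDENCY (verbatim):
«continuum YM on T⁴ ⇐ BetaPertH ∧ nine spine estimates (0/9 proved); BetaPertH ⇐ (D1) ∧ (D4) ∧ CAP+tail; G-an2-4 gates asym, D1 and
NE2/3/4.»  [folklore] explicit one-variable real analysis (concavity of `sin`, `SymbolTaylor`/`SymbolRate`/`AliasWeightsClosedForm` BY NAME);
two harmless real `def`s (`eK`, the scaled King symbol of ONE coordinate, and `wMaj`, the reading majorant); NO cited fact, NO `def … : Prop`,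
NO wall binder, NO unit re-typed.  NOT summit progress; nothing of (CONV-C)'s K-slot is discharged here.

## Why the EXTENDED zone
Part 1's factorisation puts the whole level-dependence of the T-summand into the real numbers `rf(q_i)² = 4Lc² sin²(q_i/2Lc)/eK_N(q_i)`
(`rf_sq_eq`) and `ℓ_N(q) = Σ_i eK_N(q_i)`, `eK_N(q) := N²·4 sin²(q/(2N))`.  The symmetric labels `q_i = p_i + 2π·srep m i` satisfy
`|q_i| ≤ π(N+1)` — for EVEN `N` the boundary class `srep = N/2` sits OUTSIDE King's zone `|q_i| ≤ πN`.  Instead of a case split we use the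
weaker Jordan constant on `[0, 5π/6]`: `sin x ≥ x/6` (`sin_ge_div_six`, chord of the concave sine through `sin(5π/6) = 1/2`), valid for
`|q_i|/(2N) ≤ 5π/6`, i.e. `|q_i| ≤ 5πN/3 ⊇ π(N+1)` once `N ≥ 2` (`label_zone`).  All constants below are pure numbers (c3).

## What is proved (`0 < N ≤ N′`, all real `q` unless a zone is named)
* §1 `sin_ge_div_six`, `abs_sin_ge_div_six`; `eK`: `0 ≤ eK ≤ q²` (`eK_le_sq`), `|eK_N − q²| ≤ q⁴/(12N²)`, `|eK_{N′} − eK_N| ≤ q⁴/(6N²)`,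
  extended-zone lower bound `q²/36 ≤ eK_N(q)` (`sq_div_le_eK`), `1/eK ≤ 36/q²`, reciprocal two-level rate `|eK_{N′}⁻¹ − eK_N⁻¹| ≤ 216/N²`
  and its RELATIVE form `≤ (6q²/N²)·eK_N⁻¹`.
* §2 the D-dimensional symbol `ℓ_N(q) = Σ_i eK_N(q_i) = latticeSymbol N⁻¹ 0 q` (`ell_eq_latticeSymbol`): `momSq q/36 ≤ ℓ_N ≤ momSq q`,
  `|ℓ_{N′} − ℓ_N| ≤ momSq q²/(6N²)` (`SymbolRate` BY NAME), `|ℓ_{N′}⁻¹ − ℓ_N⁻¹| ≤ 216/N²`, `|ℓ_{N′}⁻² − ℓ_N⁻²| ≤ 559872/(N²·momSq q)`.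
* §3 the reading factor of part 1: `rf N M 0 = 1`, `rf² ≤ 1`, CLOSED FORM `rf N M q ² = 4Lc² sin²(q/(2Lc))/eK_N(q)` (`N = M·Lc`, `q ≠ 0`,
  extended zone), the MAJORANT `wMaj Lc q := min 1 (144Lc²/max(q²,1))` with `rf² ≤ wMaj` (`rf_sq_le_wMaj`), and the two-level rate at the SAME
  ratio `M/N = M′/N′ = Lc⁻¹`: `|rf_{N′,M′}(q)² − rf_{N,M}(q)²| ≤ (6q²/N²)·wMaj Lc q` (`abs_rf_sq_two_level_le`) — the `q²` is paid back by
  `1/ℓ ≤ 36/|q|²` in part 3.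
Consumers: part 3 `GAN24/FibreRateTBlockLabel` (per-label rate/bound of the normalised T-summand), the R/S sums of the L11 division.
-/

noncomputable section

open Complex Finset
open scoped BigOperators Real
open Literature.MathematicalPhysics.QuantumFieldTheory.King1986 (latticeSymbol momSq momSq_nonneg)
open Summit.QuantumFields.BalabanUV.Beta.GAN24.AliasObjects (gs)
open Summit.QuantumFields.BalabanUV.Beta.GAN24.FibreRateTBlock (rf rf_nonneg)

namespace Summit.QuantumFields.BalabanUV.Beta.GAN24.FibreRateTBlockRate

variable {D : ℕ}

/-! ## §1 The extended Jordan bound and the one-coordinate King symbol -/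

/-- [folklore] **`sin x ≥ x/6` on `[0, 5π/6]`** (chord of the concave sine through `(0,0)` and `(5π/6, 1/2)`: `sin x ≥ 3x/(5π) ≥ x/6`). -/
theorem sin_ge_div_six {x : ℝ} (h0 : 0 ≤ x) (h1 : x ≤ 5 * π / 6) : x / 6 ≤ Real.sin x := by
  have hπ := Real.pi_pos
  have hπ3 := Real.pi_lt_d2
  have ha : 5 * π / 6 ∈ Set.Icc 0 π := ⟨by positivity, by linarith⟩
  have h0' : (0 : ℝ) ∈ Set.Icc 0 π := ⟨le_rfl, hπ.le⟩
  set b := x / (5 * π / 6) with hb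
  have hb0 : 0 ≤ b := by positivity
  have hb1 : b ≤ 1 := by rw [hb, div_le_one (by positivity)]; exact h1
  have hconc := strictConcaveOn_sin_Icc.concaveOn.2 h0' ha (sub_nonneg.2 hb1) hb0 (by ring)
  simp only [Real.sin_zero, smul_eq_mul, mul_zero, zero_add] at hconc
  have hsin : Real.sin (5 * π / 6) = 1 / 2 := by
    rw [show 5 * π / 6 = π - π / 6 by ring, Real.sin_pi_sub, Real.sin_pi_div_six]
  rw [hsin] at hconc
  have hx : b * (5 * π / 6) = x := by rw [hb]; field_simp
  rw [hx] at hconc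
  -- hconc : b * (1/2) ≤ sin x, and b = 6x/(5π) ≥ ... ⇒ x/6 ≤ 3x/(5π) = b/2
  have hb2 : x / 6 ≤ b * (1 / 2) := by
    rw [hb]
    rw [div_le_iff₀ (by norm_num : (0:ℝ) < 6)]
    field_simp
    nlinarith
  linarith

/-- [folklore] `|sin x| ≥ |x|/6` for `|x| ≤ 5π/6`. -/
theorem abs_sin_ge_div_six {x : ℝ} (h : |x| ≤ 5 * π / 6) : |x| / 6 ≤ |Real.sin x| := by
  rcases le_total 0 x with hx | hx
  · rw [abs_of_nonneg hx] at h ⊢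
    exact (sin_ge_div_six hx h).trans (le_abs_self _)
  · rw [abs_of_nonpos hx] at h ⊢
    have h' := sin_ge_div_six (neg_nonneg.2 hx) h
    rw [Real.sin_neg] at h'
    exact h'.trans (neg_le_abs _)

/-- [folklore] The SCALED KING SYMBOL of one coordinate: `eK N q = N²·4 sin²(q/(2N))` (`→ q²`; `SymbolTaylor`'s currency). -/
def eK (N q : ℝ) : ℝ := N ^ 2 * (4 * Real.sin (q / (2 * N)) ^ 2)

/-- [folklore] `0 ≤ eK`. -/
theorem eK_nonneg (N q : ℝ) : 0 ≤ eK N q := by unfold eK; positivity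

/-- [folklore] `eK_N(q) ≤ q²` (`SymbolTaylor.sq_mul_four_sin_sq_le_sq`). -/
theorem eK_le_sq {N : ℝ} (hN : N ≠ 0) (q : ℝ) : eK N q ≤ q ^ 2 := SymbolTaylor.sq_mul_four_sin_sq_le_sq hN q

/-- [folklore] `|eK_N(q) − q²| ≤ q⁴/(12N²)` (`SymbolTaylor.abs_sq_mul_four_sin_sq_sub_sq_le`). -/
theorem abs_eK_sub_sq_le {N : ℝ} (hN : N ≠ 0) (q : ℝ) : |eK N q - q ^ 2| ≤ q ^ 4 / (12 * N ^ 2) :=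
  SymbolTaylor.abs_sq_mul_four_sin_sq_sub_sq_le hN q

/-- [folklore] TWO-LEVEL rate `|eK_{N′}(q) − eK_N(q)| ≤ q⁴/(6N²)` for `0 < N ≤ N′`. -/
theorem abs_eK_two_level_le {N N' : ℝ} (hN : 0 < N) (hNN' : N ≤ N') (q : ℝ) : |eK N' q - eK N q| ≤ q ^ 4 / (6 * N ^ 2) := by
  have hN' : 0 < N' := lt_of_lt_of_le hN hNN'
  have h1 := abs_eK_sub_sq_le hN.ne' q
  have h2 := abs_eK_sub_sq_le hN'.ne' q
  have h3 : q ^ 4 / (12 * N' ^ 2) ≤ q ^ 4 / (12 * N ^ 2) := by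
    apply div_le_div_of_nonneg_left (by positivity) (by positivity)
    nlinarith [mul_le_mul hNN' hNN' hN.le hN'.le]
  calc |eK N' q - eK N q| = |(eK N' q - q ^ 2) - (eK N q - q ^ 2)| := by ring_nf
    _ ≤ |eK N' q - q ^ 2| + |eK N q - q ^ 2| := abs_sub _ _
    _ ≤ q ^ 4 / (12 * N ^ 2) + q ^ 4 / (12 * N ^ 2) := add_le_add (h2.trans h3) h1
    _ = q ^ 4 / (6 * N ^ 2) := by ring

/-- [folklore] **EXTENDED-ZONE LOWER BOUND** `q²/36 ≤ eK_N(q)` for `|q| ≤ 5πN/3` (`N > 0`). -/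
theorem sq_div_le_eK {N : ℝ} (hN : 0 < N) {q : ℝ} (hq : |q| ≤ 5 * π / 3 * N) : q ^ 2 / 36 ≤ eK N q := by
  have hx : |q / (2 * N)| ≤ 5 * π / 6 := by
    rw [abs_div, abs_of_pos (by positivity : (0:ℝ) < 2 * N), div_le_iff₀ (by positivity)]
    linarith
  have hs := abs_sin_ge_div_six hx
  have hq' : |q / (2 * N)| = |q| / (2 * N) := by rw [abs_div, abs_of_pos (by positivity : (0:ℝ) < 2 * N)]
  rw [hq'] at hs
  -- |sin(q/2N)| ≥ |q|/(12N)
  have h1 : |q| / (12 * N) ≤ |Real.sin (q / (2 * N))| := by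
    calc |q| / (12 * N) = |q| / (2 * N) / 6 := by field_simp; ring
      _ ≤ _ := hs
  have h2 : (|q| / (12 * N)) ^ 2 ≤ Real.sin (q / (2 * N)) ^ 2 := by
    rw [← sq_abs (Real.sin _)]
    exact pow_le_pow_left₀ (by positivity) h1 2
  unfold eK
  calc q ^ 2 / 36 = N ^ 2 * (4 * (|q| / (12 * N)) ^ 2) := by rw [div_pow, sq_abs]; field_simp; ring
    _ ≤ N ^ 2 * (4 * Real.sin (q / (2 * N)) ^ 2) := by gcongr

/-- [folklore] On the extended zone `eK_N(q) > 0` for `q ≠ 0`. -/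
theorem eK_pos {N : ℝ} (hN : 0 < N) {q : ℝ} (hq : |q| ≤ 5 * π / 3 * N) (hq0 : q ≠ 0) : 0 < eK N q :=
  lt_of_lt_of_le (by positivity) (sq_div_le_eK hN hq)

/-- [folklore] `eK_N(q)⁻¹ ≤ 36/q²` on the extended zone (`q ≠ 0`). -/
theorem inv_eK_le {N : ℝ} (hN : 0 < N) {q : ℝ} (hq : |q| ≤ 5 * π / 3 * N) (hq0 : q ≠ 0) : (eK N q)⁻¹ ≤ 36 / q ^ 2 := by
  have h := sq_div_le_eK hN hq
  have hq2 : 0 < q ^ 2 := by positivity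
  rw [inv_eq_one_div, div_le_div_iff₀ (eK_pos hN hq hq0) hq2]
  linarith

/-- [folklore] The extended zone is monotone in the level. -/
theorem zone_mono {N N' : ℝ} (hNN' : N ≤ N') {q : ℝ} (hq : |q| ≤ 5 * π / 3 * N) : |q| ≤ 5 * π / 3 * N' :=
  hq.trans (mul_le_mul_of_nonneg_left hNN' (by positivity))

/-- [folklore] **RECIPROCAL TWO-LEVEL RATE, RELATIVE FORM**: `|eK_{N′}⁻¹ − eK_N⁻¹| ≤ (6q²/N²)·eK_N⁻¹` on the extended zone, `q ≠ 0`, `0 < N ≤ N′`. -/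
theorem abs_inv_eK_two_level_le_rel {N N' : ℝ} (hN : 0 < N) (hNN' : N ≤ N') {q : ℝ} (hq : |q| ≤ 5 * π / 3 * N) (hq0 : q ≠ 0) :
    |(eK N' q)⁻¹ - (eK N q)⁻¹| ≤ 6 * q ^ 2 / N ^ 2 * (eK N q)⁻¹ := by
  have hN' : 0 < N' := lt_of_lt_of_le hN hNN'
  have he := eK_pos hN hq hq0
  have he' := eK_pos hN' (zone_mono hNN' hq) hq0
  have hrate := abs_eK_two_level_le hN hNN' q
  have hlow' := sq_div_le_eK hN' (zone_mono hNN' hq)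
  rw [inv_sub_inv he'.ne' he.ne', abs_div, abs_mul, abs_of_pos he, abs_of_pos he', abs_sub_comm]
  rw [div_le_iff₀ (mul_pos he' he)]
  have hq2 : 0 < q ^ 2 := by positivity
  calc |eK N' q - eK N q| ≤ q ^ 4 / (6 * N ^ 2) := hrate
    _ = 6 * q ^ 2 / N ^ 2 * (q ^ 2 / 36) := by ring
    _ ≤ 6 * q ^ 2 / N ^ 2 * eK N' q := by gcongr
    _ = 6 * q ^ 2 / N ^ 2 * (eK N q)⁻¹ * (eK N' q * eK N q) := by field_simp

/-- [folklore] RECIPROCAL TWO-LEVEL RATE, ABSOLUTE FORM: `|eK_{N′}⁻¹ − eK_N⁻¹| ≤ 216/N²` on the extended zone, `q ≠ 0`. -/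
theorem abs_inv_eK_two_level_le {N N' : ℝ} (hN : 0 < N) (hNN' : N ≤ N') {q : ℝ} (hq : |q| ≤ 5 * π / 3 * N) (hq0 : q ≠ 0) :
    |(eK N' q)⁻¹ - (eK N q)⁻¹| ≤ 216 / N ^ 2 := by
  have h := abs_inv_eK_two_level_le_rel hN hNN' hq hq0
  have h2 := inv_eK_le hN hq hq0
  have hq2 : 0 < q ^ 2 := by positivity
  calc |(eK N' q)⁻¹ - (eK N q)⁻¹| ≤ 6 * q ^ 2 / N ^ 2 * (eK N q)⁻¹ := h
    _ ≤ 6 * q ^ 2 / N ^ 2 * (36 / q ^ 2) := by gcongr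
    _ = 216 / N ^ 2 := by field_simp; ring

/-! ## §2 The `D`-dimensional scaled symbol `ℓ_N(q) = Σ_i eK_N(q_i)` -/

/-- [folklore] `Σ_i eK_N(q_i) = latticeSymbol N⁻¹ 0 q` (`SymbolTaylor.sum_sq_mul_four_sin_sq_eq_latticeSymbol`). -/
theorem ell_eq_latticeSymbol {N : ℝ} (hN : N ≠ 0) (q : Fin D → ℝ) : ∑ i, eK N (q i) = latticeSymbol N⁻¹ 0 q :=
  SymbolTaylor.sum_sq_mul_four_sin_sq_eq_latticeSymbol hN q

/-- [folklore] `momSq q/36 ≤ ℓ_N(q)` on the extended zone (every coordinate). -/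
theorem momSq_div_le_ell {N : ℝ} (hN : 0 < N) {q : Fin D → ℝ} (hq : ∀ i, |q i| ≤ 5 * π / 3 * N) :
    momSq q / 36 ≤ latticeSymbol N⁻¹ 0 q := by
  rw [← ell_eq_latticeSymbol hN.ne', momSq, Finset.sum_div]
  exact Finset.sum_le_sum fun i _ => sq_div_le_eK hN (hq i)

/-- [folklore] `ℓ_N(q) ≤ momSq q`. -/
theorem ell_le_momSq {N : ℝ} (hN : N ≠ 0) (q : Fin D → ℝ) : latticeSymbol N⁻¹ 0 q ≤ momSq q := by
  rw [← ell_eq_latticeSymbol hN, momSq]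
  exact Finset.sum_le_sum fun i _ => eK_le_sq hN (q i)

/-- [folklore] `ℓ_N(q) > 0` for `q ≠ 0` on the extended zone. -/
theorem ell_pos {N : ℝ} (hN : 0 < N) {q : Fin D → ℝ} (hq : ∀ i, |q i| ≤ 5 * π / 3 * N) (hq0 : q ≠ 0) :
    0 < latticeSymbol N⁻¹ 0 q := by
  have hm : 0 < momSq q := by
    obtain ⟨i, hi⟩ : ∃ i, q i ≠ 0 := by
      by_contra h
      push Not at h
      exact hq0 (funext h)
    exact lt_of_lt_of_le (by positivity : 0 < q i ^ 2) (Finset.single_le_sum (fun j _ => sq_nonneg (q j)) (Finset.mem_univ i))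
  exact lt_of_lt_of_le (by positivity) (momSq_div_le_ell hN hq)

/-- [folklore] `ℓ_N⁻¹ ≤ 36/momSq q` on the extended zone (`q ≠ 0`). -/
theorem inv_ell_le {N : ℝ} (hN : 0 < N) {q : Fin D → ℝ} (hq : ∀ i, |q i| ≤ 5 * π / 3 * N) (hq0 : q ≠ 0) :
    (latticeSymbol N⁻¹ 0 q)⁻¹ ≤ 36 / momSq q := by
  have hl := ell_pos hN hq hq0
  have hm : 0 < momSq q := lt_of_lt_of_le hl (ell_le_momSq hN.ne' q)
  have h := momSq_div_le_ell hN hq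
  rw [inv_eq_one_div, div_le_div_iff₀ hl hm]
  linarith

/-- [folklore] **RECIPROCAL TWO-LEVEL RATE of `ℓ`**: `|ℓ_{N′}⁻¹ − ℓ_N⁻¹| ≤ 216/N²` on the extended zone (`q ≠ 0`, `0 < N ≤ N′`). -/
theorem abs_inv_ell_two_level_le {N N' : ℝ} (hN : 0 < N) (hNN' : N ≤ N') {q : Fin D → ℝ} (hq : ∀ i, |q i| ≤ 5 * π / 3 * N) (hq0 : q ≠ 0) :
    |(latticeSymbol N'⁻¹ 0 q)⁻¹ - (latticeSymbol N⁻¹ 0 q)⁻¹| ≤ 216 / N ^ 2 := by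
  have hN' : 0 < N' := lt_of_lt_of_le hN hNN'
  have hq' : ∀ i, |q i| ≤ 5 * π / 3 * N' := fun i => zone_mono hNN' (hq i)
  have hl := ell_pos hN hq hq0
  have hl' := ell_pos hN' hq' hq0
  have hrate := SymbolRate.abs_latticeSymbol_two_level_le' hN hNN' q
  have hlow := momSq_div_le_ell hN hq
  have hlow' := momSq_div_le_ell hN' hq'
  have hm0 : 0 ≤ momSq q / 36 := div_nonneg (momSq_nonneg q) (by norm_num)
  rw [inv_sub_inv hl'.ne' hl.ne', abs_div, abs_mul, abs_of_pos hl, abs_of_pos hl', abs_sub_comm, div_le_iff₀ (mul_pos hl' hl)]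
  calc |latticeSymbol N'⁻¹ 0 q - latticeSymbol N⁻¹ 0 q| ≤ momSq q ^ 2 / (6 * N ^ 2) := hrate
    _ = 216 / N ^ 2 * ((momSq q / 36) * (momSq q / 36)) := by ring
    _ ≤ 216 / N ^ 2 * (latticeSymbol N'⁻¹ 0 q * latticeSymbol N⁻¹ 0 q) := by gcongr

/-- [folklore] **SQUARED-RECIPROCAL TWO-LEVEL RATE of `ℓ`**: `|ℓ_{N′}⁻² − ℓ_N⁻²| ≤ 559872/(N²·momSq q)` on the extended zone. -/
theorem abs_inv_sq_ell_two_level_le {N N' : ℝ} (hN : 0 < N) (hNN' : N ≤ N') {q : Fin D → ℝ} (hq : ∀ i, |q i| ≤ 5 * π / 3 * N) (hq0 : q ≠ 0) :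
    |((latticeSymbol N'⁻¹ 0 q) ^ 2)⁻¹ - ((latticeSymbol N⁻¹ 0 q) ^ 2)⁻¹| ≤ 559872 / (N ^ 2 * momSq q) := by
  have hN' : 0 < N' := lt_of_lt_of_le hN hNN'
  have hq' : ∀ i, |q i| ≤ 5 * π / 3 * N' := fun i => zone_mono hNN' (hq i)
  have hl := ell_pos hN hq hq0
  have hl' := ell_pos hN' hq' hq0
  have hrate := SymbolRate.abs_latticeSymbol_two_level_le' hN hNN' q
  have hlow := momSq_div_le_ell hN hq
  have hlow' := momSq_div_le_ell hN' hq'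
  have hup := ell_le_momSq hN.ne' q
  have hup' := ell_le_momSq hN'.ne' q
  have hm : 0 < momSq q := lt_of_lt_of_le hl hup
  set a := latticeSymbol N'⁻¹ 0 q
  set b := latticeSymbol N⁻¹ 0 q
  -- a⁻² − b⁻² = (b − a)(b + a)/(a²b²)
  have e : (a ^ 2)⁻¹ - (b ^ 2)⁻¹ = (b - a) * (b + a) / (a ^ 2 * b ^ 2) := by field_simp; ring
  rw [e, abs_div, abs_mul, abs_of_pos (by positivity : 0 < a ^ 2 * b ^ 2), abs_of_pos (by linarith : 0 < b + a), abs_sub_comm,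
    div_le_div_iff₀ (by positivity) (by positivity)]
  -- |a − b|·(a + b)·N²·momSq ≤ 559872·a²b²
  have h36a : momSq q ≤ 36 * a := by linarith
  have h36b : momSq q ≤ 36 * b := by linarith
  calc |a - b| * (b + a) * (N ^ 2 * momSq q) ≤ momSq q ^ 2 / (6 * N ^ 2) * (momSq q + momSq q) * (N ^ 2 * momSq q) := by
        gcongr
    _ = momSq q ^ 4 / 3 := by field_simp; ring
    _ = (momSq q * momSq q) * (momSq q * momSq q) / 3 := by ring
    _ ≤ ((36 * a) * (36 * a)) * ((36 * b) * (36 * b)) / 3 := by gcongr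
    _ = 559872 * (a ^ 2 * b ^ 2) := by ring

/-! ## §3 The reading factor: closed form, majorant, two-level rate -/

/-- [folklore] `rf N M 0 = 1` (`gs 0 M = M`, `M ≠ 0`). -/
theorem rf_zero (N M : ℕ) (hM : M ≠ 0) : rf N M 0 = 1 := by
  unfold rf gs
  have hM' : (M : ℝ) ≠ 0 := Nat.cast_ne_zero.2 hM
  simp [hM']

/-- [folklore] `rf ≤ 1` (`‖G‖ ≤ M`, `AliasWeights.norm_geomExp_le`). -/
theorem rf_le_one (N M : ℕ) (q : ℝ) : rf N M q ≤ 1 := by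
  unfold rf
  rcases Nat.eq_zero_or_pos M with hM | hM
  · subst hM; simp
  · rw [div_le_one (by exact_mod_cast hM)]
    exact AliasWeights.norm_geomExp_le _ _

/-- [folklore] `rf² ≤ 1`. -/
theorem rf_sq_le_one (N M : ℕ) (q : ℝ) : rf N M q ^ 2 ≤ 1 := by
  have h := rf_le_one N M q
  have h0 := rf_nonneg N M q
  nlinarith

/-- [folklore] The label coordinates lie in the extended zone: `|q| ≤ π(N+1) ≤ 5πN/3` for `N ≥ 2` — usable with `srep`'s window
`|srep m i| ≤ N/2` and `|p_i| ≤ π` (`label_zone`). -/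
theorem label_zone {N : ℕ} (hN : 2 ≤ N) {p : ℝ} (hp : |p| ≤ π) {s : ℤ} (hs : s.natAbs ≤ N / 2) :
    |p + 2 * π * (s : ℝ)| ≤ 5 * π / 3 * (N : ℝ) := by
  have hπ := Real.pi_pos
  have hs' : |(s : ℝ)| ≤ (N : ℝ) / 2 := by
    have h1 : |(s : ℝ)| = ((s.natAbs : ℕ) : ℝ) := by rw [Nat.cast_natAbs, Int.cast_abs]
    rw [h1]
    have h2 : ((s.natAbs : ℕ) : ℝ) ≤ ((N / 2 : ℕ) : ℝ) := by exact_mod_cast hs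
    exact h2.trans (Nat.cast_div_le.trans (by norm_num))
  have hN' : (2 : ℝ) ≤ N := by exact_mod_cast hN
  calc |p + 2 * π * (s : ℝ)| ≤ |p| + |2 * π * (s : ℝ)| := abs_add_le _ _
    _ = |p| + 2 * π * |(s : ℝ)| := by rw [abs_mul, abs_of_pos (by positivity : (0:ℝ) < 2 * π)]
    _ ≤ π + 2 * π * ((N : ℝ) / 2) := by gcongr
    _ = π * (N + 1) := by ring
    _ ≤ 5 * π / 3 * N := by nlinarith

/-- [folklore] On the extended zone a nonzero coordinate has `sin(q/(2N)) ≠ 0`. -/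
theorem sin_half_ne_zero {N : ℕ} (hN : 0 < N) {q : ℝ} (hq : |q| ≤ 5 * π / 3 * (N : ℝ)) (hq0 : q ≠ 0) : Real.sin (q / N / 2) ≠ 0 := by
  have hN' : (0 : ℝ) < N := by exact_mod_cast hN
  have he := eK_pos hN' hq hq0
  unfold eK at he
  intro h
  rw [show q / N / 2 = q / (2 * N) by ring] at h
  rw [h] at he
  simp at he

/-- [folklore] **CLOSED FORM OF THE SQUARED READING FACTOR**: `rf N M q ² = 4Lc² sin²(q/(2Lc)) / eK_N(q)` for `N = M·Lc`, `q ≠ 0` on the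
extended zone (`‖G(x,M)‖ = |sin(Mx/2)|/|sin(x/2)|`, `AliasWeightsClosedForm.norm_geomExp_eq_div`). -/
theorem rf_sq_eq {N M Lc : ℕ} (hM : 0 < M) (hLc : 0 < Lc) (hNM : N = M * Lc) {q : ℝ} (hq : |q| ≤ 5 * π / 3 * (N : ℝ)) (hq0 : q ≠ 0) :
    rf N M q ^ 2 = 4 * (Lc : ℝ) ^ 2 * Real.sin (q / (2 * Lc)) ^ 2 / eK N q := by
  have hN : 0 < N := by rw [hNM]; exact Nat.mul_pos hM hLc
  have hN' : (0 : ℝ) < N := by exact_mod_cast hN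
  have hM' : (0 : ℝ) < M := by exact_mod_cast hM
  have hLc' : (0 : ℝ) < Lc := by exact_mod_cast hLc
  have hNr : (N : ℝ) = M * Lc := by rw [hNM]; push_cast; ring
  have hs := sin_half_ne_zero hN hq hq0
  have hclosed := AliasWeightsClosedForm.norm_geomExp_eq_div (q / N) M hs
  unfold rf
  rw [ReadingWeightRatesSum.gs_eq, hclosed]
  have e1 : (M : ℝ) * (q / N) / 2 = q / (2 * Lc) := by rw [hNr]; field_simp
  have e2 : q / (N : ℝ) / 2 = q / (2 * N) := by ring
  rw [e1, e2, div_pow, div_pow, sq_abs, sq_abs]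
  unfold eK
  have hsin : Real.sin (q / (2 * N)) ^ 2 ≠ 0 := by
    rw [← e2]; exact pow_ne_zero 2 hs
  field_simp
  rw [hNr]
  ring

/-- [folklore] THE READING MAJORANT `wMaj Lc q = min(1, 144Lc²/max(q², 1))` (the `max` keeps it `= 1` near `q = 0`, where `rf = 1`). -/
def wMaj (Lc : ℕ) (q : ℝ) : ℝ := min 1 (144 * (Lc : ℝ) ^ 2 / max (q ^ 2) 1)

/-- [folklore] `0 ≤ wMaj ≤ 1`. -/
theorem wMaj_nonneg (Lc : ℕ) (q : ℝ) : 0 ≤ wMaj Lc q :=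
  le_min zero_le_one (div_nonneg (by positivity) (le_trans zero_le_one (le_max_right _ _)))

/-- [folklore] `wMaj ≤ 1`. -/
theorem wMaj_le_one (Lc : ℕ) (q : ℝ) : wMaj Lc q ≤ 1 := min_le_left _ _

/-- [folklore] Decay form: `wMaj Lc q ≤ 144Lc²/q²` for `1 ≤ q²`. -/
theorem wMaj_le_div {Lc : ℕ} {q : ℝ} (hq : 1 ≤ q ^ 2) : wMaj Lc q ≤ 144 * (Lc : ℝ) ^ 2 / q ^ 2 := by
  unfold wMaj
  rw [max_eq_left hq]
  exact min_le_right _ _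

/-- [folklore] **`rf² ≤ wMaj`** on the extended zone (`N = M·Lc`, `M, Lc ≥ 1`; all `q`, the origin included). -/
theorem rf_sq_le_wMaj {N M Lc : ℕ} (hM : 0 < M) (hLc : 0 < Lc) (hNM : N = M * Lc) {q : ℝ} (hq : |q| ≤ 5 * π / 3 * (N : ℝ)) :
    rf N M q ^ 2 ≤ wMaj Lc q := by
  have h1 := rf_sq_le_one N M q
  unfold wMaj
  refine le_min h1 ?_
  by_cases hq1 : q ^ 2 ≤ 1
  · rw [max_eq_right hq1]
    have hLc' : (1 : ℝ) ≤ Lc := by exact_mod_cast hLc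
    calc rf N M q ^ 2 ≤ 1 := h1
      _ ≤ 144 * (Lc : ℝ) ^ 2 / 1 := by rw [div_one]; nlinarith
  · push Not at hq1
    rw [max_eq_left hq1.le]
    have hq0 : q ≠ 0 := by rintro rfl; norm_num at hq1
    have hN : 0 < N := by rw [hNM]; exact Nat.mul_pos hM hLc
    have hN' : (0 : ℝ) < N := by exact_mod_cast hN
    rw [rf_sq_eq hM hLc hNM hq hq0]
    have he := inv_eK_le hN' hq hq0
    have hinv : 0 ≤ (eK (N : ℝ) q)⁻¹ := inv_nonneg.2 (eK_nonneg _ _)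
    have hsin : Real.sin (q / (2 * Lc)) ^ 2 ≤ 1 := by
      rw [← sq_abs]; have := Real.abs_sin_le_one (q / (2 * Lc)); nlinarith [abs_nonneg (Real.sin (q / (2 * Lc)))]
    calc 4 * (Lc : ℝ) ^ 2 * Real.sin (q / (2 * Lc)) ^ 2 / eK N q = 4 * (Lc : ℝ) ^ 2 * Real.sin (q / (2 * Lc)) ^ 2 * (eK N q)⁻¹ := by
          rw [div_eq_mul_inv]
      _ ≤ 4 * (Lc : ℝ) ^ 2 * 1 * (36 / q ^ 2) := by gcongr
      _ = 144 * (Lc : ℝ) ^ 2 / q ^ 2 := by ring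

/-- [folklore] **TWO-LEVEL RATE OF THE SQUARED READING FACTOR** at the same ratio `M/N = M′/N′ = Lc⁻¹` (`N′ = N·Lc`, `M′ = N = M·Lc`):
`|rf_{N′,M′}(q)² − rf_{N,M}(q)²| ≤ (6q²/N²)·wMaj Lc q` on the extended zone (all `q`). -/
theorem abs_rf_sq_two_level_le {N M Lc : ℕ} (hM : 0 < M) (hLc : 0 < Lc) (hNM : N = M * Lc) {q : ℝ} (hq : |q| ≤ 5 * π / 3 * (N : ℝ)) :
    |rf (N * Lc) N q ^ 2 - rf N M q ^ 2| ≤ 6 * q ^ 2 / (N : ℝ) ^ 2 * wMaj Lc q := by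
  have hN : 0 < N := by rw [hNM]; exact Nat.mul_pos hM hLc
  have hN' : (0 : ℝ) < N := by exact_mod_cast hN
  rcases eq_or_ne q 0 with rfl | hq0
  · rw [rf_zero _ _ hM.ne', rf_zero _ _ hN.ne']; simp
  have hNN' : (N : ℝ) ≤ ((N * Lc : ℕ) : ℝ) := by
    have : N ≤ N * Lc := Nat.le_mul_of_pos_right N hLc
    exact_mod_cast this
  have hq' : |q| ≤ 5 * π / 3 * ((N * Lc : ℕ) : ℝ) := zone_mono hNN' hq
  have e : ∀ a b c : ℝ, a / b - a / c = a * (b⁻¹ - c⁻¹) := fun a b c => by ring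
  rw [rf_sq_eq hN hLc rfl hq' hq0, rf_sq_eq hM hLc hNM hq hq0, e, abs_mul, abs_of_nonneg (by positivity)]
  have hrel := abs_inv_eK_two_level_le_rel hN' hNN' hq hq0
  have hw := rf_sq_le_wMaj hM hLc hNM hq
  rw [rf_sq_eq hM hLc hNM hq hq0] at hw
  calc 4 * (Lc : ℝ) ^ 2 * Real.sin (q / (2 * Lc)) ^ 2 * |(eK ((N * Lc : ℕ) : ℝ) q)⁻¹ - (eK N q)⁻¹|
      ≤ 4 * (Lc : ℝ) ^ 2 * Real.sin (q / (2 * Lc)) ^ 2 * (6 * q ^ 2 / N ^ 2 * (eK N q)⁻¹) :=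
        mul_le_mul_of_nonneg_left hrel (by positivity)
    _ = 6 * q ^ 2 / N ^ 2 * (4 * (Lc : ℝ) ^ 2 * Real.sin (q / (2 * Lc)) ^ 2 / eK N q) := by ring
    _ ≤ 6 * q ^ 2 / N ^ 2 * wMaj Lc q := mul_le_mul_of_nonneg_left hw (by positivity)

end Summit.QuantumFields.BalabanUV.Beta.GAN24.FibreRateTBlockRate

end
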